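import Mathlib.Combinatorics.SimpleGraph.AdjMatrix
import Mathlib.Algebra.Order.BigOperators.Ring.Finset
import Mathlib.Analysis.Real.Sqrt
import Mathlib.Tactic.Linarith
import Mathlib.Tactic.FieldSimp
import Mathlib.Tactic.Ring
import HarnessLib

/-!
# Kunisky–Yu §3.4: from the adjacency matrix to the Seidel matrix in the pair block

Pure matrix bookkeeping for the proof of Kunisky–Yu 2022, Theorem 1.2 (arXiv:2211.02713, §3.4,
Proposition 3.19 and the expansions (52), (54)). Throughout, `S` is the Seidel matrix of a graph `G`
in KY's convention (hypothesis `hS : S_{ab} = 0, +1, −1` according as `a = b`, `a ∼ b`, `a ≁ b`),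
`A = G.adjMatrix ℝ`, and `Vm` is a symmetric matrix with zero diagonal (the pair block of a test
vector). We prove:

* `adjMatrix_eq_seidel` — `A_{xy} = (1 + S_{xy})/2 − [x = y]/2` (KY Proposition 3.19).
* `sum_adj_sandwich_eq` —
  `Σ_{a,b,d} Vm_{ab}A_{bd}Vm_{da} = ½(Σ_a(Σ_b Vm_{ab})² + Σ Vm S Vm − Σ Vm²)`
  (the shapes `T^{3,0,1}`, `T^{3,1,1}` of KY (52)).
* `adj_prod_eq_delta_mul` — on the disjoint block, `A_{ac}A_{ad}A_{bc}A_{bd} = δ₄·∏(1+S)/16` with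
  `δ₄` the indicator that `{a,b} ∩ {c,d} = ∅` (KY (52), third case).
* `sum_delta4_eq` — `Σ Vm_{ab}Vm_{cd} δ₄ = σ₀² − 4G₂ + 2N₂` (KY Proposition 3.28, `T^{4,0,1}`, in
  quadratic-form language: `σ₀ = ΣVm`, `G₂ = Σ_a(Σ_b Vm_{ab})²`, `N₂ = ΣVm²`).
* `sum_adj_prod_eq` — hence `Σ Vm Vm AAAA = (σ₀² − 4G₂ + 2N₂)/16 + R_dis/16` with
  `R_dis = Σ Vm_{ab}Vm_{cd} δ₄ (∏(1+S) − 1)` the sum of the fifteen non-trivial graph-matrix shapes.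
* `abs_sub_le_of_coincidence` — the coincidence correction: dropping `δ₄` costs at most
  `60 q N₂`, `|R_dis − Σ VmVm(∏(1+S) − 1)| ≤ 60·|V|·N₂` (elementary replacement for the `Δ`
  corrections of KY §4.4–4.6).

No number theory and no spectral input is used here.

## References

* [KuniskyYu2022] D. Kunisky, X. Yu, arXiv:2211.02713, Prop. 3.19, (52), (54), Props. 3.24, 3.28.
-/

noncomputable section

namespace Literature.Combinatorics.SimpleGraph

open Matrix Finset

section AdjToSeidel

variable {V : Type*} [Fintype V] [DecidableEq V] (G : _root_.SimpleGraph V) [DecidableRel G.Adj]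

omit [Fintype V] in
/-- **Kunisky–Yu, Proposition 3.19** for one pair: `A_{xy} = (1 + S_{xy})/2 − [x = y]/2`
("`½(1 + χ(a − b))` is the indicator of the edge `{a,b}`").
[cite: KuniskyYu2022, Proposition 3.19] -/
theorem adjMatrix_eq_seidel {S : Matrix V V ℝ}
    (hS : ∀ a b, S a b = if a = b then 0 else if G.Adj a b then 1 else -1) (x y : V) :
    G.adjMatrix ℝ x y = (1 + S x y) / 2 - if x = y then 1 / 2 else 0 := by
  rw [SimpleGraph.adjMatrix_apply, hS]
  by_cases h : x = y
  · subst h; simp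
  · rw [if_neg h, if_neg h]
    by_cases hadj : G.Adj x y
    · rw [if_pos hadj, if_pos hadj]; norm_num
    · rw [if_neg hadj, if_neg hadj]; norm_num

/-- **The overlap shapes through `S`** (KY (52), second case: `T^{3,0,1}` and `T^{3,1,1}`): for `Vm`
symmetric,
`Σ_{a,b,d} Vm_{ab}A_{bd}Vm_{da} = ½(Σ_a(Σ_b Vm_{ab})² + Σ_{a,b,d} Vm_{ab}S_{bd}Vm_{da} − Σ Vm²)`.
[cite: KuniskyYu2022, (52)] -/
theorem sum_adj_sandwich_eq {S : Matrix V V ℝ}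
    (hS : ∀ a b, S a b = if a = b then 0 else if G.Adj a b then 1 else -1)
    (Vm : Matrix V V ℝ) (hVs : ∀ x y, Vm x y = Vm y x) :
    ∑ a, ∑ b, ∑ d, Vm a b * G.adjMatrix ℝ b d * Vm d a =
      (1 / 2) * (∑ a, (∑ b, Vm a b) ^ 2 + ∑ a, ∑ b, ∑ d, Vm a b * S b d * Vm d a -
        ∑ a, ∑ b, Vm a b ^ 2) := by
  have e : ∀ a b d, Vm a b * G.adjMatrix ℝ b d * Vm d a =
      (1 / 2) * (Vm a b * Vm d a) + (1 / 2) * (Vm a b * S b d * Vm d a) -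
        (if b = d then (1 / 2) * (Vm a b * Vm d a) else 0) := by
    intro a b d
    rw [adjMatrix_eq_seidel G hS]
    split_ifs <;> ring
  simp only [e, Finset.sum_add_distrib, Finset.sum_sub_distrib, Finset.sum_ite_eq, mem_univ,
    if_true]
  have h1 : ∑ a, ∑ b, ∑ d, 1 / 2 * (Vm a b * Vm d a) = 1 / 2 * ∑ a, (∑ b, Vm a b) ^ 2 := by
    rw [Finset.mul_sum]
    refine Finset.sum_congr rfl fun a _ => ?_
    rw [sq, Finset.sum_mul_sum, Finset.mul_sum]
    refine Finset.sum_congr rfl fun b _ => ?_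
    rw [Finset.mul_sum]
    exact Finset.sum_congr rfl fun d _ => by rw [hVs d a]
  have h2 : ∑ a, ∑ b, ∑ d, 1 / 2 * (Vm a b * S b d * Vm d a) =
      1 / 2 * ∑ a, ∑ b, ∑ d, Vm a b * S b d * Vm d a := by
    simp only [Finset.mul_sum]
  have h3 : ∑ a, ∑ b, 1 / 2 * (Vm a b * Vm b a) = 1 / 2 * ∑ a, ∑ b, Vm a b ^ 2 := by
    simp only [Finset.mul_sum]
    exact Finset.sum_congr rfl fun a _ => Finset.sum_congr rfl fun b _ => by rw [hVs b a, sq]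
  rw [h1, h2, h3]
  ring

omit [Fintype V] in
/-- **The disjoint block through `S`** (KY (52), third case): for all vertices,
`A_{ac}A_{ad}A_{bc}A_{bd} = δ₄(a,b,c,d) · (1+S_{ac})(1+S_{ad})(1+S_{bc})(1+S_{bd}) / 16`, where
`δ₄ = [a≠c][a≠d][b≠c][b≠d]` (both sides vanish when a cross pair coincides, by irreflexivity).
[cite: KuniskyYu2022, (52)] -/
theorem adj_prod_eq_delta_mul {S : Matrix V V ℝ}
    (hS : ∀ a b, S a b = if a = b then 0 else if G.Adj a b then 1 else -1) (a b c d : V) :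
    G.adjMatrix ℝ a c * G.adjMatrix ℝ a d * G.adjMatrix ℝ b c * G.adjMatrix ℝ b d =
      ((if a = c then 0 else 1) * (if a = d then 0 else 1) * (if b = c then 0 else 1) *
        (if b = d then 0 else 1)) *
        ((1 + S a c) * (1 + S a d) * (1 + S b c) * (1 + S b d)) / 16 := by
  by_cases hac : a = c
  · subst hac; simp
  by_cases had : a = d
  · subst had; simp
  by_cases hbc : b = c
  · subst hbc; simp
  by_cases hbd : b = d
  · subst hbd; simp
  rw [adjMatrix_eq_seidel G hS, adjMatrix_eq_seidel G hS, adjMatrix_eq_seidel G hS,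
    adjMatrix_eq_seidel G hS, if_neg hac, if_neg had, if_neg hbc, if_neg hbd, if_neg hac,
    if_neg had, if_neg hbc, if_neg hbd]
  ring

omit [DecidableRel G.Adj] in
/-- **`Σ Vm_{ab}Vm_{cd} δ₄ = σ₀² − 4G₂ + 2N₂`** (the shape `T^{4,0,1}` as a quadratic form; KY
Proposition 3.28 `T^{4,0,1} = ((p−2)(p−3)/2)P₀ − (p−3)P₁ + P₂` in coordinates), for `Vm` symmetric
with zero diagonal, by inclusion–exclusion over the coincidences `a=c, a=d, b=c, b=d`.
[cite: KuniskyYu2022, Proposition 3.28] -/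
theorem sum_delta4_eq (Vm : Matrix V V ℝ) (hVs : ∀ x y, Vm x y = Vm y x) (hVd : ∀ x, Vm x x = 0) :
    ∑ a, ∑ b, ∑ c, ∑ d, Vm a b * Vm c d *
      ((if a = c then 0 else 1) * (if a = d then 0 else 1) * (if b = c then 0 else 1) *
        (if b = d then 0 else (1 : ℝ))) =
      (∑ a, ∑ b, Vm a b) ^ 2 - 4 * ∑ a, (∑ b, Vm a b) ^ 2 + 2 * ∑ a, ∑ b, Vm a b ^ 2 := by
  -- pointwise inclusion–exclusion (the degenerate double coincidences carry `Vm_{aa} = 0`)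
  have e : ∀ a b c d, Vm a b * Vm c d *
      ((if a = c then 0 else 1) * (if a = d then 0 else 1) * (if b = c then 0 else 1) *
        (if b = d then 0 else (1 : ℝ))) =
      Vm a b * Vm c d - (if a = c then Vm a b * Vm c d else 0) -
        (if a = d then Vm a b * Vm c d else 0) - (if b = c then Vm a b * Vm c d else 0) -
        (if b = d then Vm a b * Vm c d else 0) +
        (if b = d then (if a = c then Vm a b * Vm c d else 0) else 0) +
        (if a = d then (if b = c then Vm a b * Vm c d else 0) else 0) := by
    intro a b c d
    by_cases hab : a = b
    · subst hab; simp [hVd]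
    by_cases hcd : c = d
    · subst hcd; simp [hVd]
    by_cases hac : a = c
    · have had : a ≠ d := fun h => hcd (hac.symm.trans h)
      have hbc : b ≠ c := fun h => hab (hac.trans h.symm)
      simp only [if_pos hac, if_neg had, if_neg hbc]
      by_cases hbd : b = d
      · simp only [if_pos hbd]; ring
      · simp only [if_neg hbd]; ring
    · simp only [if_neg hac]
      by_cases had : a = d
      · have hbd : b ≠ d := fun h => hab (had.trans h.symm)
        simp only [if_pos had, if_neg hbd]
        by_cases hbc : b = c
        · simp only [if_pos hbc]; ring
        · simp only [if_neg hbc]; ring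
      · simp only [if_neg had]
        by_cases hbc : b = c
        · have hbd : b ≠ d := fun h => hcd (hbc.symm.trans h)
          simp only [if_pos hbc, if_neg hbd]; ring
        · simp only [if_neg hbc]
          by_cases hbd : b = d
          · simp only [if_pos hbd]; ring
          · simp only [if_neg hbd]; ring
  simp only [e, Finset.sum_add_distrib, Finset.sum_sub_distrib]
  -- the individual sums
  set σ : ℝ := ∑ a, ∑ b, Vm a b with hσ
  have s0 : ∑ a, ∑ b, ∑ c, ∑ d, Vm a b * Vm c d = σ ^ 2 := by
    have h1 : ∀ a b, ∑ c, ∑ d, Vm a b * Vm c d = Vm a b * σ := by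
      intro a b; rw [hσ, Finset.mul_sum]
      exact Finset.sum_congr rfl fun c _ => by rw [Finset.mul_sum]
    simp only [h1, ← Finset.sum_mul]
    rw [← hσ]; ring
  -- `[a=c]`: `Σ_{a,b,d} Vm_ab Vm_ad`
  have s1 : ∑ a, ∑ b, ∑ c, ∑ d, (if a = c then Vm a b * Vm c d else 0) =
      ∑ a, (∑ b, Vm a b) ^ 2 := by
    refine Finset.sum_congr rfl fun a _ => ?_
    rw [sq, Finset.sum_mul_sum]
    refine Finset.sum_congr rfl fun b _ => ?_
    rw [Finset.sum_comm]
    simp only [Finset.sum_ite_eq, mem_univ, if_true]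
  -- `[a=d]`: `Σ_{a,b,c} Vm_ab Vm_ca`
  have s2 : ∑ a, ∑ b, ∑ c, ∑ d, (if a = d then Vm a b * Vm c d else 0) =
      ∑ a, (∑ b, Vm a b) ^ 2 := by
    simp only [Finset.sum_ite_eq, mem_univ, if_true]
    refine Finset.sum_congr rfl fun a _ => ?_
    rw [sq, Finset.sum_mul_sum]
    exact Finset.sum_congr rfl fun b _ => Finset.sum_congr rfl fun c _ => by rw [hVs c a]
  -- `[b=c]`: `Σ_{a,b,d} Vm_ab Vm_bd = Σ_b (Σ_a Vm_ab)(Σ_d Vm_bd)`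
  have s3 : ∑ a, ∑ b, ∑ c, ∑ d, (if b = c then Vm a b * Vm c d else 0) =
      ∑ a, (∑ b, Vm a b) ^ 2 := by
    have h1 : ∀ a b, ∑ c, ∑ d, (if b = c then Vm a b * Vm c d else 0) = ∑ d, Vm a b * Vm b d := by
      intro a b; rw [Finset.sum_comm]; simp only [Finset.sum_ite_eq, mem_univ, if_true]
    simp only [h1]
    rw [Finset.sum_comm]
    refine Finset.sum_congr rfl fun b _ => ?_
    rw [sq, Finset.sum_mul_sum]
    exact Finset.sum_congr rfl fun a _ => Finset.sum_congr rfl fun d _ => by rw [hVs a b]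
  -- `[b=d]`: `Σ_{a,b,c} Vm_ab Vm_cb`
  have s4 : ∑ a, ∑ b, ∑ c, ∑ d, (if b = d then Vm a b * Vm c d else 0) =
      ∑ a, (∑ b, Vm a b) ^ 2 := by
    simp only [Finset.sum_ite_eq, mem_univ, if_true]
    rw [Finset.sum_comm]
    refine Finset.sum_congr rfl fun b _ => ?_
    rw [sq, Finset.sum_mul_sum]
    exact Finset.sum_congr rfl fun a _ => Finset.sum_congr rfl fun c _ => by rw [hVs a b, hVs c b]
  -- `[a=c][b=d]`
  have s5 : ∑ a, ∑ b, ∑ c, ∑ d, (if b = d then (if a = c then Vm a b * Vm c d else 0) else 0) =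
      ∑ a, ∑ b, Vm a b ^ 2 := by
    simp only [Finset.sum_ite_eq, mem_univ, if_true]
    exact Finset.sum_congr rfl fun a _ => Finset.sum_congr rfl fun b _ => by ring
  -- `[a=d][b=c]`
  have s6 : ∑ a, ∑ b, ∑ c, ∑ d, (if a = d then (if b = c then Vm a b * Vm c d else 0) else 0) =
      ∑ a, ∑ b, Vm a b ^ 2 := by
    simp only [Finset.sum_ite_eq, mem_univ, if_true]
    exact Finset.sum_congr rfl fun a _ => Finset.sum_congr rfl fun b _ => by rw [hVs b a]; ring
  rw [s0, s1, s2, s3, s4, s5, s6]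
  ring

/-- **The disjoint block, summed** (KY (54) restricted to the shape decomposition of the `α₄`
term): for `Vm` symmetric with zero diagonal,
`Σ VmVm A_{ac}A_{ad}A_{bc}A_{bd} = (σ₀² − 4G₂ + 2N₂)/16 + (1/16) Σ VmVm δ₄ (∏(1+S) − 1)`.
[cite: KuniskyYu2022, (54)] -/
theorem sum_adj_prod_eq {S : Matrix V V ℝ}
    (hS : ∀ a b, S a b = if a = b then 0 else if G.Adj a b then 1 else -1)
    (Vm : Matrix V V ℝ) (hVs : ∀ x y, Vm x y = Vm y x) (hVd : ∀ x, Vm x x = 0) :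
    ∑ a, ∑ b, ∑ c, ∑ d, Vm a b * Vm c d *
      (G.adjMatrix ℝ a c * G.adjMatrix ℝ a d * G.adjMatrix ℝ b c * G.adjMatrix ℝ b d) =
      ((∑ a, ∑ b, Vm a b) ^ 2 - 4 * ∑ a, (∑ b, Vm a b) ^ 2 + 2 * ∑ a, ∑ b, Vm a b ^ 2) / 16 +
      (1 / 16) * ∑ a, ∑ b, ∑ c, ∑ d, Vm a b * Vm c d *
        (((if a = c then 0 else 1) * (if a = d then 0 else 1) * (if b = c then 0 else 1) *
          (if b = d then 0 else (1 : ℝ))) *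
          ((1 + S a c) * (1 + S a d) * (1 + S b c) * (1 + S b d) - 1)) := by
  have e : ∀ a b c d, Vm a b * Vm c d *
      (G.adjMatrix ℝ a c * G.adjMatrix ℝ a d * G.adjMatrix ℝ b c * G.adjMatrix ℝ b d) =
      (1 / 16) * (Vm a b * Vm c d *
        ((if a = c then 0 else 1) * (if a = d then 0 else 1) * (if b = c then 0 else 1) *
          (if b = d then 0 else (1 : ℝ)))) +
      (1 / 16) * (Vm a b * Vm c d *
        (((if a = c then 0 else 1) * (if a = d then 0 else 1) * (if b = c then 0 else 1) *
          (if b = d then 0 else (1 : ℝ))) *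
          ((1 + S a c) * (1 + S a d) * (1 + S b c) * (1 + S b d) - 1))) := by
    intro a b c d
    rw [adj_prod_eq_delta_mul G hS]
    ring
  simp only [e, Finset.sum_add_distrib, ← Finset.mul_sum]
  rw [sum_delta4_eq Vm hVs hVd]
  ring

omit [DecidableEq V] [DecidableRel G.Adj] in
/-- `(Σ_b |x_b|)² ≤ q Σ_b x_b²` (Cauchy–Schwarz against the all-ones vector). [folklore] -/
theorem sq_sum_abs_le_card_mul_sum_sq (x : V → ℝ) :
    (∑ b, |x b|) ^ 2 ≤ Fintype.card V * ∑ b, x b ^ 2 := by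
  have h := Finset.sum_mul_sq_le_sq_mul_sq (univ : Finset V) (fun _ => (1 : ℝ)) (fun b => |x b|)
  simp only [one_mul, one_pow, sum_const, card_univ, nsmul_eq_mul, mul_one, sq_abs] at h
  exact h

/-- **The coincidence correction is small**: with `|S_{xy}| ≤ 1`, dropping the disjointness
indicator `δ₄` from `Σ VmVm δ₄ (∏(1+S) − 1)` changes it by at most `60·q·N₂`
(each coincidence makes the two factors `Vm_{ab}, Vm_{cd}` share an index, and
`Σ_a (Σ_b |Vm_{ab}|)² ≤ q N₂`). Elementary replacement for the `Δ`-corrections of KY §4.4–§4.6.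
[cite: KuniskyYu2022, §4.4] -/
theorem abs_sub_le_of_coincidence {S : Matrix V V ℝ} (hSb : ∀ x y, |S x y| ≤ 1)
    (Vm : Matrix V V ℝ) (hVs : ∀ x y, Vm x y = Vm y x) :
    |∑ a, ∑ b, ∑ c, ∑ d, Vm a b * Vm c d *
        (((if a = c then 0 else 1) * (if a = d then 0 else 1) * (if b = c then 0 else 1) *
          (if b = d then 0 else (1 : ℝ))) *
          ((1 + S a c) * (1 + S a d) * (1 + S b c) * (1 + S b d) - 1)) -
      ∑ a, ∑ b, ∑ c, ∑ d, Vm a b * Vm c d *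
        ((1 + S a c) * (1 + S a d) * (1 + S b c) * (1 + S b d) - 1)| ≤
      60 * Fintype.card V * ∑ a, ∑ b, Vm a b ^ 2 := by
  -- pointwise bound
  have hP : ∀ a b c d, |(1 + S a c) * (1 + S a d) * (1 + S b c) * (1 + S b d) - 1| ≤ 15 := by
    intro a b c d
    have h1 := abs_le.1 (hSb a c); have h2 := abs_le.1 (hSb a d)
    have h3 := abs_le.1 (hSb b c); have h4 := abs_le.1 (hSb b d)
    rw [abs_le]
    constructor
    · nlinarith [mul_nonneg (mul_nonneg (by linarith : (0:ℝ) ≤ 1 + S a c)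
        (by linarith : (0:ℝ) ≤ 1 + S a d)) (mul_nonneg (by linarith : (0:ℝ) ≤ 1 + S b c)
        (by linarith : (0:ℝ) ≤ 1 + S b d))]
    · have hx : (1 + S a c) * (1 + S a d) ≤ 4 := by nlinarith
      have hy : (1 + S b c) * (1 + S b d) ≤ 4 := by nlinarith
      have hx0 : 0 ≤ (1 + S a c) * (1 + S a d) := by nlinarith
      have hy0 : 0 ≤ (1 + S b c) * (1 + S b d) := by nlinarith
      nlinarith [mul_le_mul hx hy hy0 (by norm_num : (0:ℝ) ≤ 4)]
  have hpt : ∀ a b c d, |Vm a b * Vm c d *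
      (((if a = c then 0 else 1) * (if a = d then 0 else 1) * (if b = c then 0 else 1) *
        (if b = d then 0 else (1 : ℝ))) *
        ((1 + S a c) * (1 + S a d) * (1 + S b c) * (1 + S b d) - 1)) -
      Vm a b * Vm c d * ((1 + S a c) * (1 + S a d) * (1 + S b c) * (1 + S b d) - 1)| ≤
      15 * ((if a = c then |Vm a b| * |Vm c d| else 0) +
        (if a = d then |Vm a b| * |Vm c d| else 0) +
        (if b = c then |Vm a b| * |Vm c d| else 0) +
        (if b = d then |Vm a b| * |Vm c d| else 0)) := by
    intro a b c d
    have hP' := hP a b c d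
    set P := (1 + S a c) * (1 + S a d) * (1 + S b c) * (1 + S b d) - 1 with hPdef
    have hVV : 0 ≤ |Vm a b| * |Vm c d| := mul_nonneg (abs_nonneg _) (abs_nonneg _)
    have key : |Vm a b * Vm c d * P| ≤ 15 * (|Vm a b| * |Vm c d|) := by
      rw [abs_mul, abs_mul]
      calc |Vm a b| * |Vm c d| * |P| ≤ |Vm a b| * |Vm c d| * 15 :=
            mul_le_mul_of_nonneg_left hP' hVV
        _ = 15 * (|Vm a b| * |Vm c d|) := by ring
    have h0a : 0 ≤ (if a = d then |Vm a b| * |Vm c d| else 0) := by positivity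
    have h0b : 0 ≤ (if b = c then |Vm a b| * |Vm c d| else 0) := by positivity
    have h0c : 0 ≤ (if b = d then |Vm a b| * |Vm c d| else 0) := by positivity
    have h0d : 0 ≤ (if a = c then |Vm a b| * |Vm c d| else 0) := by positivity
    by_cases hac : a = c
    · rw [if_pos hac]
      simp only [zero_mul, mul_zero, zero_sub, abs_neg, if_pos hac]
      linarith
    by_cases had : a = d
    · rw [if_pos had]
      simp only [if_neg hac, zero_mul, mul_zero, zero_sub, abs_neg, if_pos had]
      linarith
    by_cases hbc : b = c
    · rw [if_pos hbc]
      simp only [if_neg hac, if_neg had, zero_mul, mul_zero, one_mul, zero_sub, abs_neg, if_pos hbc]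
      linarith
    by_cases hbd : b = d
    · rw [if_pos hbd]
      simp only [if_neg hac, if_neg had, if_neg hbc, mul_zero, one_mul, zero_mul, zero_sub, abs_neg,
        if_pos hbd]
      linarith
    · simp only [if_neg hac, if_neg had, if_neg hbc, if_neg hbd, one_mul, sub_self, abs_zero]
      norm_num
  -- sum the pointwise bound
  rw [← Finset.sum_sub_distrib]
  simp only [← Finset.sum_sub_distrib]
  refine (Finset.abs_sum_le_sum_abs _ _).trans ?_
  refine (Finset.sum_le_sum fun a _ => (Finset.abs_sum_le_sum_abs _ _).trans
    (Finset.sum_le_sum fun b _ => (Finset.abs_sum_le_sum_abs _ _).trans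
      (Finset.sum_le_sum fun c _ => (Finset.abs_sum_le_sum_abs _ _).trans
        (Finset.sum_le_sum fun d _ => hpt a b c d)))).trans ?_
  -- evaluate the four indicator sums: each is `Σ_x (Σ_y |Vm_xy|)²`
  set W : ℝ := ∑ a, (∑ b, |Vm a b|) ^ 2 with hW
  have hVa : ∀ x y, |Vm x y| = |Vm y x| := fun x y => by rw [hVs x y]
  have t1 : ∑ a, ∑ b, ∑ c, ∑ d, (if a = c then |Vm a b| * |Vm c d| else 0) = W := by
    refine Finset.sum_congr rfl fun a _ => ?_
    rw [sq, Finset.sum_mul_sum]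
    refine Finset.sum_congr rfl fun b _ => ?_
    rw [Finset.sum_comm]
    simp only [Finset.sum_ite_eq, mem_univ, if_true]
  have t2 : ∑ a, ∑ b, ∑ c, ∑ d, (if a = d then |Vm a b| * |Vm c d| else 0) = W := by
    simp only [Finset.sum_ite_eq, mem_univ, if_true]
    refine Finset.sum_congr rfl fun a _ => ?_
    rw [sq, Finset.sum_mul_sum]
    exact Finset.sum_congr rfl fun b _ => Finset.sum_congr rfl fun c _ => by rw [hVa c a]
  have t3 : ∑ a, ∑ b, ∑ c, ∑ d, (if b = c then |Vm a b| * |Vm c d| else 0) = W := by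
    have h1 : ∀ a b, ∑ c, ∑ d, (if b = c then |Vm a b| * |Vm c d| else 0) =
        ∑ d, |Vm a b| * |Vm b d| := by
      intro a b; rw [Finset.sum_comm]; simp only [Finset.sum_ite_eq, mem_univ, if_true]
    simp only [h1]
    rw [Finset.sum_comm]
    refine Finset.sum_congr rfl fun b _ => ?_
    rw [sq, Finset.sum_mul_sum]
    exact Finset.sum_congr rfl fun a _ => Finset.sum_congr rfl fun d _ => by rw [hVa a b]
  have t4 : ∑ a, ∑ b, ∑ c, ∑ d, (if b = d then |Vm a b| * |Vm c d| else 0) = W := by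
    simp only [Finset.sum_ite_eq, mem_univ, if_true]
    rw [Finset.sum_comm]
    refine Finset.sum_congr rfl fun b _ => ?_
    rw [sq, Finset.sum_mul_sum]
    exact Finset.sum_congr rfl fun a _ => Finset.sum_congr rfl fun c _ => by rw [hVa a b, hVa c b]
  have hsum : ∑ a, ∑ b, ∑ c, ∑ d, 15 * ((if a = c then |Vm a b| * |Vm c d| else 0) +
      (if a = d then |Vm a b| * |Vm c d| else 0) + (if b = c then |Vm a b| * |Vm c d| else 0) +
      (if b = d then |Vm a b| * |Vm c d| else 0)) = 60 * W := by
    have hd : ∀ a b c d : V, 15 * ((if a = c then |Vm a b| * |Vm c d| else 0) +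
        (if a = d then |Vm a b| * |Vm c d| else 0) + (if b = c then |Vm a b| * |Vm c d| else 0) +
        (if b = d then |Vm a b| * |Vm c d| else 0)) =
        15 * (if a = c then |Vm a b| * |Vm c d| else 0) +
        15 * (if a = d then |Vm a b| * |Vm c d| else 0) +
        15 * (if b = c then |Vm a b| * |Vm c d| else 0) +
        15 * (if b = d then |Vm a b| * |Vm c d| else 0) := by intros; ring
    simp only [hd, Finset.sum_add_distrib, ← Finset.mul_sum]
    rw [t1, t2, t3, t4]; ring
  rw [hsum]
  -- `W ≤ q N₂`
  have hWle : W ≤ Fintype.card V * ∑ a, ∑ b, Vm a b ^ 2 := by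
    rw [hW, Finset.mul_sum]
    exact Finset.sum_le_sum fun a _ => sq_sum_abs_le_card_mul_sum_sq (fun b => Vm a b)
  nlinarith

end AdjToSeidel

end Literature.Combinatorics.SimpleGraph

end
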